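import Literature.NumberTheory.Automorphic.LeviEmbeddingGLLie
import Literature.NumberTheory.Automorphic.LeviEmbeddingGLHeight
import HarnessLib

/-!
# Restriction of functions on `GL_{k+l}(𝔸_K)` to the Levi `GL_k(𝔸_K) × GL_l(𝔸_K)`: level,
# smoothness, `K_∞`-slices, `K_∞`-finiteness, growth, and the left invariance of constant terms
(Borel–Jacquet 1979, 4.4; Moeglin–Waldspurger 1995, I.2.6, I.2.17)

Topic `NumberTheory/Automorphic`; sequel of `LeviEmbeddingGL`, `LeviEmbeddingGLLie`,
`LeviEmbeddingGLHeight` and `ConstantTermBlockGLParabolic`. For a function `ψ` on `GL_{k+l}(𝔸_K)`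
and `m₂ ∈ GL_l(𝔸_K)` (resp. `m₁ ∈ GL_k(𝔸_K)`) the **Levi functions**
`leviFunLeft ψ m₂ = (m₁ ↦ ψ (diag(m₁, m₂)))` on `GL_k(𝔸_K)` and
`leviFunRight ψ m₁ = (m₂ ↦ ψ (diag(m₁, m₂)))` on `GL_l(𝔸_K)` inherit the conditions of automorphy
(Borel–Jacquet 1979, 4.2) from `ψ`, except left invariance and `Z`-finiteness:

* `exists_level_leviFunLeft` / `_Right` — **level**: if `ψ` is right invariant under the level
  `(1, U₀)`, `U₀ ≤ GL_{k+l}(𝔸_K^∞)` compact open, then `leviFunLeft ψ m₂` is right invariant under the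
  admissible level `(1, U₁₀)`, `U₁₀ = GL_k(𝒪̂_K) ∩ {u | diag(u, 1) ∈ U₀}` (compact open);
* `isArchSmooth_leviFunLeft` / `_Right` — **smoothness in the archimedean variable** (the
  one-parameter subgroups of the factor are those of `GL_{k+l}` along `diag(X, 0)`,
  `glArch_expMem_smul_inclLeftLie`, and `X ↦ diag(X, 0)` is linear);
* `leviFunLeft_slice_mem` / `_Right` — **`K_∞`-slices**: if the slices `κ ↦ ψ (g κ)` of `ψ` lie in a
  finite-dimensional space `M`, those of the Levi function lie in `M ∘ leviKLeft`
  (`leviKLeft : K_∞^{(k)} → K_∞^{(k+l)}`, `c ↦ diag(c, 1)`), again finite-dimensional and right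
  stable (`map_funLeft_leviKLeft_stable`);
* `isKFinite_of_forall_slice_mem` — **a function all of whose `K_∞`-slices lie in a finite-dimensional
  space of functions on `K_∞` is `K_∞`-finite** (its right `K_∞`-translates lie in the span of the
  coordinate functions in a basis);
* `exists_norm_leviFunLeft_le` / `_Right` — **moderate growth with the same exponent**
  (`one_sup_adelicHeightGL_leviGL_le`);
* `IsLeftInvariant.leviFunLeft_blockCT` / `_Right` — **for a constant term `ψ = φ_P` of a continuous
  left `GL_{k+l}(K)`-invariant `φ` along `P_k` (additive Haar measure on the box), the Levi functions are
  left `GL_k(K)`- resp. `GL_l(K)`-invariant** (`φ_P` is left `P_k(K)`-invariant,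
  `IsLeftInvariant.blockCT_parabolic_rational_mul`, and rational Levi elements are rational elements of
  `P_k`).

These are the elementary properties behind "the constant term along `P` is an automorphic form on
the Levi" (Moeglin–Waldspurger I.2.6, I.2.17; Borel–Jacquet 4.4) used in Harish-Chandra's finiteness
theorem; the `Z(𝔪)`-finiteness is the subject of the sequel. Everything here is proved; the
definitions are `leviFunLeft`, `leviFunRight`, `leviKLeft`, `leviKRight`.

## References

* A. Borel, H. Jacquet, *Automorphic forms and automorphic representations* (1979), 4.2–4.4
  [BorelJacquet1979].
* C. Moeglin, J.-L. Waldspurger, *Spectral decomposition and Eisenstein series* (1995), I.2.6,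
  I.2.17 [MoeglinWaldspurger1995].
-/

-- Mathlib idiom (Mathlib/Algebra/Lie/OfAssociative.lean); needed to mention Lie subalgebras of matrix algebras
attribute [local instance 100] LieRing.ofAssociativeRing

noncomputable section

open scoped Matrix MatrixGroups Classical ContDiff RestrictedProduct
open NumberField IsDedekindDomain NumberField.mixedEmbedding

namespace Literature.NumberTheory.Automorphic

-- `M_n(K ⊗ ℝ)` is finite-dimensional over `ℝ` (the tree's instance, as in `CuspFormArchConvolution`)
attribute [local instance] finiteDimensional_matrix_mixedSpace

variable {K : Type} [Field K] [NumberField K] {k l : ℕ}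

/-! ### 1. The Levi functions -/

section Defs

/-- **The Levi function of the first factor**: `m₁ ↦ ψ (diag(m₁, m₂))` on `GL_k(𝔸_K)`, for `ψ` a
function on `GL_{k+l}(𝔸_K)` and `m₂ ∈ GL_l(𝔸_K)`. Moeglin–Waldspurger 1995, I.2.17.
[cite: MoeglinWaldspurger1995, I.2.17] -/
def leviFunLeft (ψ : GL (Fin (k + l)) (AdeleRing (𝓞 K) K) → ℂ) (m₂ : GL (Fin l) (AdeleRing (𝓞 K) K)) :
    GL (Fin k) (AdeleRing (𝓞 K) K) → ℂ :=
  fun m₁ => ψ (leviGL (AdeleRing (𝓞 K) K) k l (m₁, m₂))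

/-- **The Levi function of the second factor**: `m₂ ↦ ψ (diag(m₁, m₂))` on `GL_l(𝔸_K)`.
[cite: MoeglinWaldspurger1995, I.2.17] -/
def leviFunRight (ψ : GL (Fin (k + l)) (AdeleRing (𝓞 K) K) → ℂ) (m₁ : GL (Fin k) (AdeleRing (𝓞 K) K)) :
    GL (Fin l) (AdeleRing (𝓞 K) K) → ℂ :=
  fun m₂ => ψ (leviGL (AdeleRing (𝓞 K) K) k l (m₁, m₂))

/-- Unfolding of `leviFunLeft`. [folklore] -/
@[simp]
theorem leviFunLeft_apply (ψ : GL (Fin (k + l)) (AdeleRing (𝓞 K) K) → ℂ) (m₂ : GL (Fin l) (AdeleRing (𝓞 K) K))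
    (m₁ : GL (Fin k) (AdeleRing (𝓞 K) K)) :
    leviFunLeft ψ m₂ m₁ = ψ (leviGL (AdeleRing (𝓞 K) K) k l (m₁, m₂)) :=
  rfl

/-- Unfolding of `leviFunRight`. [folklore] -/
@[simp]
theorem leviFunRight_apply (ψ : GL (Fin (k + l)) (AdeleRing (𝓞 K) K) → ℂ) (m₁ : GL (Fin k) (AdeleRing (𝓞 K) K))
    (m₂ : GL (Fin l) (AdeleRing (𝓞 K) K)) :
    leviFunRight ψ m₁ m₂ = ψ (leviGL (AdeleRing (𝓞 K) K) k l (m₁, m₂)) :=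
  rfl

end Defs

/-! ### 2. Levels -/

section Level

/-- `GL_n(𝔸_K^∞)` is Hausdorff (from the restricted product). [folklore] -/
theorem t2Space_gl_finiteAdeleRing' (m : ℕ) : T2Space (GL (Fin m) (FiniteAdeleRing (𝓞 K) K)) := by
  haveI : T2Space (FiniteAdeleRing (𝓞 K) K) := inferInstanceAs <| T2Space
    (Πʳ w : HeightOneSpectrum (𝓞 K), [w.adicCompletion K, w.adicCompletionIntegers K])
  infer_instance

/-- **The level of the first Levi function.** If `ψ` is right invariant under `(1, U₀)` with
`U₀ ≤ GL_{k+l}(𝔸_K^∞)` compact open, then `leviFunLeft ψ m₂` is right invariant under the admissible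
level `(1, U₁₀) ∈ finiteLevelsGL k K`, `U₁₀ = GL_k(𝒪̂_K) ∩ {u | diag(u, 1) ∈ U₀}`.
Borel–Jacquet 1979, 4.2 (a), 4.4. [cite: BorelJacquet1979, 4.4] -/
theorem exists_level_leviFunLeft {ψ : GL (Fin (k + l)) (AdeleRing (𝓞 K) K) → ℂ}
    {U₀ : Subgroup (GL (Fin (k + l)) (FiniteAdeleRing (𝓞 K) K))}
    (hU₀o : IsOpen (U₀ : Set (GL (Fin (k + l)) (FiniteAdeleRing (𝓞 K) K))))
    (hU₀c : IsCompact (U₀ : Set (GL (Fin (k + l)) (FiniteAdeleRing (𝓞 K) K))))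
    (hψU : IsRightInvariantUnder (U₀.map (GLn.ofFinite (k + l) K)) ψ) (m₂ : GL (Fin l) (AdeleRing (𝓞 K) K)) :
    ∃ U₁ ∈ finiteLevelsGL k K, IsRightInvariantUnder U₁ (leviFunLeft ψ m₂) := by
  haveI := t2Space_gl_finiteAdeleRing' (K := K) (k + l)
  -- the finite Levi inclusion `u ↦ diag(u, 1)`
  set j : GL (Fin k) (FiniteAdeleRing (𝓞 K) K) →* GL (Fin (k + l)) (FiniteAdeleRing (𝓞 K) K) :=
    (leviGL (FiniteAdeleRing (𝓞 K) K) k l).comp (MonoidHom.inl _ _) with hj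
  have hjc : Continuous j := continuous_leviGL.comp (continuous_id.prodMk continuous_const)
  set U₁₀ : Subgroup (GL (Fin k) (FiniteAdeleRing (𝓞 K) K)) := glFiniteIntegralLevel k K ⊓ U₀.comap j with hU₁₀
  have hopen : IsOpen (U₁₀ : Set (GL (Fin k) (FiniteAdeleRing (𝓞 K) K))) :=
    (isOpen_glFiniteIntegralLevel k K).inter (hU₀o.preimage hjc)
  have hcomp : IsCompact (U₁₀ : Set (GL (Fin k) (FiniteAdeleRing (𝓞 K) K))) :=
    (show IsCompact (glFiniteIntegralLevel k K : Set (GL (Fin k) (FiniteAdeleRing (𝓞 K) K))) from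
      isCompact_glFiniteIntegralLevel_holds k K).inter_right (hU₀c.isClosed.preimage hjc)
  refine ⟨U₁₀.map (GLn.ofFinite k K), ⟨U₁₀, hopen, hcomp, rfl⟩, ?_⟩
  rintro _ ⟨u, hu, rfl⟩ m₁
  rw [leviFunLeft_apply, leviFunLeft_apply]
  have e : leviGL (AdeleRing (𝓞 K) K) k l (m₁ * GLn.ofFinite k K u, m₂) =
      leviGL (AdeleRing (𝓞 K) K) k l (m₁, m₂) * GLn.ofFinite (k + l) K (j u) := by
    rw [hj, MonoidHom.comp_apply, MonoidHom.inl_apply, GLn.ofFinite_leviGL, map_one, ← map_mul, Prod.mk_mul_mk,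
      mul_one]
  rw [e]
  exact hψU _ ⟨j u, (Subgroup.mem_inf.mp hu).2, rfl⟩ _

/-- **The level of the second Levi function** (`U₁₀ = GL_l(𝒪̂_K) ∩ {u | diag(1, u) ∈ U₀}`).
[cite: BorelJacquet1979, 4.4] -/
theorem exists_level_leviFunRight {ψ : GL (Fin (k + l)) (AdeleRing (𝓞 K) K) → ℂ}
    {U₀ : Subgroup (GL (Fin (k + l)) (FiniteAdeleRing (𝓞 K) K))}
    (hU₀o : IsOpen (U₀ : Set (GL (Fin (k + l)) (FiniteAdeleRing (𝓞 K) K))))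
    (hU₀c : IsCompact (U₀ : Set (GL (Fin (k + l)) (FiniteAdeleRing (𝓞 K) K))))
    (hψU : IsRightInvariantUnder (U₀.map (GLn.ofFinite (k + l) K)) ψ) (m₁ : GL (Fin k) (AdeleRing (𝓞 K) K)) :
    ∃ U₁ ∈ finiteLevelsGL l K, IsRightInvariantUnder U₁ (leviFunRight ψ m₁) := by
  haveI := t2Space_gl_finiteAdeleRing' (K := K) (k + l)
  set j : GL (Fin l) (FiniteAdeleRing (𝓞 K) K) →* GL (Fin (k + l)) (FiniteAdeleRing (𝓞 K) K) :=
    (leviGL (FiniteAdeleRing (𝓞 K) K) k l).comp (MonoidHom.inr _ _) with hj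
  have hjc : Continuous j := continuous_leviGL.comp (continuous_const.prodMk continuous_id)
  set U₁₀ : Subgroup (GL (Fin l) (FiniteAdeleRing (𝓞 K) K)) := glFiniteIntegralLevel l K ⊓ U₀.comap j with hU₁₀
  have hopen : IsOpen (U₁₀ : Set (GL (Fin l) (FiniteAdeleRing (𝓞 K) K))) :=
    (isOpen_glFiniteIntegralLevel l K).inter (hU₀o.preimage hjc)
  have hcomp : IsCompact (U₁₀ : Set (GL (Fin l) (FiniteAdeleRing (𝓞 K) K))) :=
    (show IsCompact (glFiniteIntegralLevel l K : Set (GL (Fin l) (FiniteAdeleRing (𝓞 K) K))) from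
      isCompact_glFiniteIntegralLevel_holds l K).inter_right (hU₀c.isClosed.preimage hjc)
  refine ⟨U₁₀.map (GLn.ofFinite l K), ⟨U₁₀, hopen, hcomp, rfl⟩, ?_⟩
  rintro _ ⟨u, hu, rfl⟩ m₂
  rw [leviFunRight_apply, leviFunRight_apply]
  have e : leviGL (AdeleRing (𝓞 K) K) k l (m₁, m₂ * GLn.ofFinite l K u) =
      leviGL (AdeleRing (𝓞 K) K) k l (m₁, m₂) * GLn.ofFinite (k + l) K (j u) := by
    rw [hj, MonoidHom.comp_apply, MonoidHom.inr_apply, GLn.ofFinite_leviGL, map_one, ← map_mul, Prod.mk_mul_mk,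
      mul_one]
  rw [e]
  exact hψU _ ⟨j u, (Subgroup.mem_inf.mp hu).2, rfl⟩ _

end Level

/-! ### 3. Smoothness in the archimedean variable -/

section Smooth

-- the scoped operator norm on `𝔤𝔩_m(K_∞)`, through which `IsArchSmooth` is defined (as in `CuspFormArchConvolution`)
open scoped Matrix.Norms.Operator

/-- The matrix slices `M ↦ ψ (h · (exp M, 1))` of a function on `GL_m(𝔸_K)` smooth in the archimedean
variable are smooth on all of `𝔤𝔩_m(K_∞)` (the pattern of `contDiff_comp_mul_expGL_of_isArchSmooth` of
`CuspFormArchConvolution`). [folklore] -/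
theorem contDiff_comp_mul_ofInfinite_expGL {m : ℕ} {ψ : GL (Fin m) (AdeleRing (𝓞 K) K) → ℂ}
    (hψ : IsArchSmooth (glArch m K) ψ) (h : GL (Fin m) (AdeleRing (𝓞 K) K)) :
    ContDiff ℝ ∞ fun M : Matrix (Fin m) (Fin m) (mixedSpace K) => ψ (h * GLn.ofInfinite m K (expGL M)) := by
  let incl : Matrix (Fin m) (Fin m) (mixedSpace K) →ₗ[ℝ] (archGroupGL m K).lie.toSubmodule :=
    LinearMap.codRestrict (archGroupGL m K).lie.toSubmodule LinearMap.id fun M => mem_archGroupGL_lie M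
  have hincl : ContDiff ℝ ∞ (incl : Matrix (Fin m) (Fin m) (mixedSpace K) → (archGroupGL m K).lie.toSubmodule) :=
    (⟨incl, incl.continuous_of_finiteDimensional⟩ :
      Matrix (Fin m) (Fin m) (mixedSpace K) →L[ℝ] (archGroupGL m K).lie.toSubmodule).contDiff
  have heq : (fun M : Matrix (Fin m) (Fin m) (mixedSpace K) => ψ (h * GLn.ofInfinite m K (expGL M))) =
      (fun X : (archGroupGL m K).lie.toSubmodule => ψ (h * glArch m K ((archGroupGL m K).expMem ⟨X, X.2⟩))) ∘ incl := by
    funext M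
    rw [Function.comp_apply, glArch_apply, RealMatrixGroup.coe_expMem]
    rfl
  rw [heq]
  exact (hψ h).comp hincl

/-- `X ↦ diag(X, 0)` restricted to the Lie algebra submodule is smooth (linear between
finite-dimensional spaces). [folklore] -/
theorem contDiff_inclLeftR_subtype :
    ContDiff ℝ ∞ fun X : (archGroupGL k K).lie.toSubmodule =>
      HCLevi.inclLeftR k l (X : Matrix (Fin k) (Fin k) (mixedSpace K)) := by
  set L : Matrix (Fin k) (Fin k) (mixedSpace K) →ₗ[ℝ] Matrix (Fin (k + l)) (Fin (k + l)) (mixedSpace K) :=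
    (HCLevi.inclLeftR (𝕜 := mixedSpace K) k l : Matrix (Fin k) (Fin k) (mixedSpace K) →ₗ⁅ℝ⁆ _).toLinearMap with hL
  have hLc : ContDiff ℝ ∞ (L : Matrix (Fin k) (Fin k) (mixedSpace K) → Matrix (Fin (k + l)) (Fin (k + l)) (mixedSpace K)) :=
    (⟨L, L.continuous_of_finiteDimensional⟩ :
      Matrix (Fin k) (Fin k) (mixedSpace K) →L[ℝ] Matrix (Fin (k + l)) (Fin (k + l)) (mixedSpace K)).contDiff
  exact hLc.comp (archGroupGL k K).lie.toSubmodule.subtypeL.contDiff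

/-- `Y ↦ diag(0, Y)` restricted to the Lie algebra submodule is smooth. [folklore] -/
theorem contDiff_inclRightR_subtype :
    ContDiff ℝ ∞ fun Y : (archGroupGL l K).lie.toSubmodule =>
      HCLevi.inclRightR k l (Y : Matrix (Fin l) (Fin l) (mixedSpace K)) := by
  set L : Matrix (Fin l) (Fin l) (mixedSpace K) →ₗ[ℝ] Matrix (Fin (k + l)) (Fin (k + l)) (mixedSpace K) :=
    (HCLevi.inclRightR (𝕜 := mixedSpace K) k l : Matrix (Fin l) (Fin l) (mixedSpace K) →ₗ⁅ℝ⁆ _).toLinearMap with hL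
  have hLc : ContDiff ℝ ∞ (L : Matrix (Fin l) (Fin l) (mixedSpace K) → Matrix (Fin (k + l)) (Fin (k + l)) (mixedSpace K)) :=
    (⟨L, L.continuous_of_finiteDimensional⟩ :
      Matrix (Fin l) (Fin l) (mixedSpace K) →L[ℝ] Matrix (Fin (k + l)) (Fin (k + l)) (mixedSpace K)).contDiff
  exact hLc.comp (archGroupGL l K).lie.toSubmodule.subtypeL.contDiff

/-- **The first Levi function of a smooth function is smooth**: `X ↦ (leviFunLeft ψ m₂)(g₁ exp X) =
ψ (diag(g₁, m₂) exp diag(X, 0))` is the composition of the smooth `M ↦ ψ (diag(g₁, m₂) exp M)` with the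
linear `X ↦ diag(X, 0)`. Borel–Jacquet 1979, 4.2 (b), 4.4. [cite: BorelJacquet1979, 4.4] -/
theorem isArchSmooth_leviFunLeft {ψ : GL (Fin (k + l)) (AdeleRing (𝓞 K) K) → ℂ}
    (hψ : IsArchSmooth (glArch (k + l) K) ψ) (m₂ : GL (Fin l) (AdeleRing (𝓞 K) K)) :
    IsArchSmooth (glArch k K) (leviFunLeft ψ m₂) := by
  intro g₁
  have heq : (fun X : (archGroupGL k K).lie.toSubmodule =>
      leviFunLeft ψ m₂ (g₁ * glArch k K ((archGroupGL k K).expMem ⟨X, X.2⟩))) =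
      (fun M : Matrix (Fin (k + l)) (Fin (k + l)) (mixedSpace K) =>
        ψ (leviGL (AdeleRing (𝓞 K) K) k l (g₁, m₂) * GLn.ofInfinite (k + l) K (expGL M))) ∘
        fun X : (archGroupGL k K).lie.toSubmodule => HCLevi.inclLeftR k l (X : Matrix (Fin k) (Fin k) (mixedSpace K)) := by
    funext X
    rw [Function.comp_apply, leviFunLeft_apply, glArch_apply, RealMatrixGroup.coe_expMem, HCLevi.inclLeftR_apply,
      ← leviGL_expGL_inl, GLn.ofInfinite_leviGL, map_one, ← map_mul, Prod.mk_mul_mk, mul_one]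
  rw [heq]
  exact (contDiff_comp_mul_ofInfinite_expGL hψ _).comp contDiff_inclLeftR_subtype

/-- **The second Levi function of a smooth function is smooth.** [cite: BorelJacquet1979, 4.4] -/
theorem isArchSmooth_leviFunRight {ψ : GL (Fin (k + l)) (AdeleRing (𝓞 K) K) → ℂ}
    (hψ : IsArchSmooth (glArch (k + l) K) ψ) (m₁ : GL (Fin k) (AdeleRing (𝓞 K) K)) :
    IsArchSmooth (glArch l K) (leviFunRight ψ m₁) := by
  intro g₂
  have heq : (fun Y : (archGroupGL l K).lie.toSubmodule =>
      leviFunRight ψ m₁ (g₂ * glArch l K ((archGroupGL l K).expMem ⟨Y, Y.2⟩))) =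
      (fun M : Matrix (Fin (k + l)) (Fin (k + l)) (mixedSpace K) =>
        ψ (leviGL (AdeleRing (𝓞 K) K) k l (m₁, g₂) * GLn.ofInfinite (k + l) K (expGL M))) ∘
        fun Y : (archGroupGL l K).lie.toSubmodule => HCLevi.inclRightR k l (Y : Matrix (Fin l) (Fin l) (mixedSpace K)) := by
    funext Y
    rw [Function.comp_apply, leviFunRight_apply, glArch_apply, RealMatrixGroup.coe_expMem, HCLevi.inclRightR_apply,
      ← leviGL_expGL_inr, GLn.ofInfinite_leviGL, map_one, ← map_mul, Prod.mk_mul_mk, mul_one]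
  rw [heq]
  exact (contDiff_comp_mul_ofInfinite_expGL hψ _).comp contDiff_inclRightR_subtype

end Smooth

/-! ### 4. `K_∞`-slices and `K_∞`-finiteness -/

section Slices

variable (k l) in
/-- `K_∞^{(k)} →* K_∞^{(k+l)}`, `c ↦ diag(c, 1)`. [folklore] -/
def leviKLeft : Kinf k K →* Kinf (k + l) K where
  toFun c := ⟨leviGL (mixedSpace K) k l ((c : GL (Fin k) (mixedSpace K)), 1), leviGL_mem_Kinf c.2 (one_mem _)⟩
  map_one' := Subtype.ext (by
    change leviGL (mixedSpace K) k l (((1 : Kinf k K) : GL (Fin k) (mixedSpace K)), 1) = 1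
    rw [Subgroup.coe_one]; exact map_one (leviGL (mixedSpace K) k l))
  map_mul' c c' := Subtype.ext (by
    change leviGL (mixedSpace K) k l (((c * c' : Kinf k K) : GL (Fin k) (mixedSpace K)), 1) =
      leviGL (mixedSpace K) k l ((c : GL (Fin k) (mixedSpace K)), 1) * leviGL (mixedSpace K) k l ((c' : GL (Fin k) (mixedSpace K)), 1)
    rw [← map_mul, Prod.mk_mul_mk, mul_one, Subgroup.coe_mul])

variable (k l) in
/-- `K_∞^{(l)} →* K_∞^{(k+l)}`, `c ↦ diag(1, c)`. [folklore] -/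
def leviKRight : Kinf l K →* Kinf (k + l) K where
  toFun c := ⟨leviGL (mixedSpace K) k l (1, (c : GL (Fin l) (mixedSpace K))), leviGL_mem_Kinf (one_mem _) c.2⟩
  map_one' := Subtype.ext (by
    change leviGL (mixedSpace K) k l (1, ((1 : Kinf l K) : GL (Fin l) (mixedSpace K))) = 1
    rw [Subgroup.coe_one]; exact map_one (leviGL (mixedSpace K) k l))
  map_mul' c c' := Subtype.ext (by
    change leviGL (mixedSpace K) k l (1, (((c * c' : Kinf l K) : GL (Fin l) (mixedSpace K)))) =
      leviGL (mixedSpace K) k l (1, (c : GL (Fin l) (mixedSpace K))) * leviGL (mixedSpace K) k l (1, (c' : GL (Fin l) (mixedSpace K)))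
    rw [← map_mul, Prod.mk_mul_mk, mul_one, Subgroup.coe_mul])

/-- The matrix-group element of `leviKLeft c` is `diag(c, 1)`. [folklore] -/
@[simp]
theorem coe_leviKLeft (c : Kinf k K) :
    ((leviKLeft k l c : Kinf (k + l) K) : GL (Fin (k + l)) (mixedSpace K)) =
      leviGL (mixedSpace K) k l ((c : GL (Fin k) (mixedSpace K)), 1) :=
  rfl

/-- The matrix-group element of `leviKRight c` is `diag(1, c)`. [folklore] -/
@[simp]
theorem coe_leviKRight (c : Kinf l K) :
    ((leviKRight k l c : Kinf (k + l) K) : GL (Fin (k + l)) (mixedSpace K)) =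
      leviGL (mixedSpace K) k l (1, (c : GL (Fin l) (mixedSpace K))) :=
  rfl

/-- `(diag(c, 1), 1) = diag((c, 1), 1)` in `GL_{k+l}(𝔸_K)`. [folklore] -/
theorem ofInfinite_leviKLeft (c : Kinf k K) :
    GLn.ofInfinite (k + l) K ((leviKLeft k l c : Kinf (k + l) K) : GL (Fin (k + l)) (mixedSpace K)) =
      leviGL (AdeleRing (𝓞 K) K) k l (GLn.ofInfinite k K (c : GL (Fin k) (mixedSpace K)), 1) := by
  rw [coe_leviKLeft, GLn.ofInfinite_leviGL, map_one]

/-- `(diag(1, c), 1) = diag(1, (c, 1))` in `GL_{k+l}(𝔸_K)`. [folklore] -/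
theorem ofInfinite_leviKRight (c : Kinf l K) :
    GLn.ofInfinite (k + l) K ((leviKRight k l c : Kinf (k + l) K) : GL (Fin (k + l)) (mixedSpace K)) =
      leviGL (AdeleRing (𝓞 K) K) k l (1, GLn.ofInfinite l K (c : GL (Fin l) (mixedSpace K))) := by
  rw [coe_leviKRight, GLn.ofInfinite_leviGL, map_one]

/-- **The `K_∞`-slices of the first Levi function**: if every slice `κ ↦ ψ (g κ)` of `ψ` lies in `M`,
then every slice `c ↦ (leviFunLeft ψ m₂)(g₁ c)` lies in `M ∘ leviKLeft` (the image of `M` under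
precomposition with `c ↦ diag(c, 1)`). Borel–Jacquet 1979, 4.4 (`φ_P` is `K`-finite on the right).
[cite: BorelJacquet1979, 4.4] -/
theorem leviFunLeft_slice_mem (M : Submodule ℂ (Kinf (k + l) K → ℂ)) {ψ : GL (Fin (k + l)) (AdeleRing (𝓞 K) K) → ℂ}
    (hψM : ∀ g : GL (Fin (k + l)) (AdeleRing (𝓞 K) K),
      (fun κ : Kinf (k + l) K => ψ (g * GLn.ofInfinite (k + l) K (κ : GL (Fin (k + l)) (mixedSpace K)))) ∈ M)
    (m₂ : GL (Fin l) (AdeleRing (𝓞 K) K)) (g₁ : GL (Fin k) (AdeleRing (𝓞 K) K)) :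
    (fun c : Kinf k K => leviFunLeft ψ m₂ (g₁ * GLn.ofInfinite k K (c : GL (Fin k) (mixedSpace K)))) ∈
      M.map (LinearMap.funLeft ℂ ℂ (leviKLeft k l (K := K))) := by
  refine ⟨_, hψM (leviGL (AdeleRing (𝓞 K) K) k l (g₁, m₂)), ?_⟩
  funext c
  rw [LinearMap.funLeft_apply, leviFunLeft_apply, ofInfinite_leviKLeft, ← map_mul, Prod.mk_mul_mk, mul_one]

/-- **The `K_∞`-slices of the second Levi function.** [cite: BorelJacquet1979, 4.4] -/
theorem leviFunRight_slice_mem (M : Submodule ℂ (Kinf (k + l) K → ℂ)) {ψ : GL (Fin (k + l)) (AdeleRing (𝓞 K) K) → ℂ}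
    (hψM : ∀ g : GL (Fin (k + l)) (AdeleRing (𝓞 K) K),
      (fun κ : Kinf (k + l) K => ψ (g * GLn.ofInfinite (k + l) K (κ : GL (Fin (k + l)) (mixedSpace K)))) ∈ M)
    (m₁ : GL (Fin k) (AdeleRing (𝓞 K) K)) (g₂ : GL (Fin l) (AdeleRing (𝓞 K) K)) :
    (fun c : Kinf l K => leviFunRight ψ m₁ (g₂ * GLn.ofInfinite l K (c : GL (Fin l) (mixedSpace K)))) ∈
      M.map (LinearMap.funLeft ℂ ℂ (leviKRight k l (K := K))) := by
  refine ⟨_, hψM (leviGL (AdeleRing (𝓞 K) K) k l (m₁, g₂)), ?_⟩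
  funext c
  rw [LinearMap.funLeft_apply, leviFunRight_apply, ofInfinite_leviKRight, ← map_mul, Prod.mk_mul_mk, mul_one]

/-- **Right stability transfers along `leviKLeft`**: if `M` is stable under `f ↦ (κ ↦ f (κ κ₀))` for
all `κ₀ ∈ K_∞^{(k+l)}`, then `M ∘ leviKLeft` is stable under `f ↦ (c ↦ f (c c₀))` for all
`c₀ ∈ K_∞^{(k)}`. [folklore] -/
theorem map_funLeft_leviKLeft_stable {M : Submodule ℂ (Kinf (k + l) K → ℂ)}
    (hM : ∀ κ₀ : Kinf (k + l) K, ∀ f ∈ M, (fun κ => f (κ * κ₀)) ∈ M) (c₀ : Kinf k K) :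
    ∀ f ∈ M.map (LinearMap.funLeft ℂ ℂ (leviKLeft k l (K := K))), (fun c => f (c * c₀)) ∈
      M.map (LinearMap.funLeft ℂ ℂ (leviKLeft k l (K := K))) := by
  rintro _ ⟨f, hf, rfl⟩
  refine ⟨_, hM (leviKLeft k l c₀) f hf, ?_⟩
  funext c
  simp only [LinearMap.funLeft_apply, map_mul]

/-- **Right stability transfers along `leviKRight`.** [folklore] -/
theorem map_funLeft_leviKRight_stable {M : Submodule ℂ (Kinf (k + l) K → ℂ)}
    (hM : ∀ κ₀ : Kinf (k + l) K, ∀ f ∈ M, (fun κ => f (κ * κ₀)) ∈ M) (c₀ : Kinf l K) :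
    ∀ f ∈ M.map (LinearMap.funLeft ℂ ℂ (leviKRight k l (K := K))), (fun c => f (c * c₀)) ∈
      M.map (LinearMap.funLeft ℂ ℂ (leviKRight k l (K := K))) := by
  rintro _ ⟨f, hf, rfl⟩
  refine ⟨_, hM (leviKRight k l c₀) f hf, ?_⟩
  funext c
  simp only [LinearMap.funLeft_apply, map_mul]

/-- **A function all of whose `K_∞`-slices lie in a finite-dimensional space of functions on `K_∞` is
`K_∞`-finite**: in a basis `(b_j)` of `M` write `κ ↦ φ (g κ) = ∑_j a_j(g) b_j`; then the right
translate `r(κ) φ = ∑_j b_j(κ) a_j` lies in the span of the finitely many `a_j`. (The converse direction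
of the dictionary between `K_∞`-types and spaces of slices; Borel–Jacquet 1979, 4.3 (i)–(ii).)
[cite: BorelJacquet1979, 4.3 (i)] -/
theorem isKFinite_of_forall_slice_mem {n : ℕ} {hcpt : isCompact_glFiniteIntegralLevel n K}
    (M : Submodule ℂ (Kinf n K → ℂ)) [FiniteDimensional ℂ M] {φ : (AdelicGroupData.gl n K).Adelic → ℂ}
    (hφM : ∀ g : GL (Fin n) (AdeleRing (𝓞 K) K),
      (fun κ : Kinf n K => φ (g * GLn.ofInfinite n K (κ : GL (Fin n) (mixedSpace K)))) ∈ M) :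
    IsKFinite (AutomorphyDatum.gl n K hcpt).ofArch φ := by
  set b := Module.finBasis ℂ M with hb
  -- the coordinate functions `a_j (g) = (b.repr (slice_g φ)) j`
  set a : Fin (Module.finrank ℂ M) → ((AdelicGroupData.gl n K).Adelic → ℂ) := fun j g =>
    b.repr ⟨_, hφM g⟩ j with ha
  have key : ∀ c : Kinf n K,
      archTranslate (AutomorphyDatum.gl n K hcpt).ofArch
        (Subgroup.inclusion (archGroupGL n K).maximalCompact_le_carrier c) φ =
      ∑ j, ((b j : M) : Kinf n K → ℂ) c • a j := by
    intro c
    funext g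
    rw [archTranslate_apply, Finset.sum_apply]
    simp only [Pi.smul_apply, smul_eq_mul]
    have h := congrArg (fun f : M => (f : Kinf n K → ℂ) c) (b.sum_repr ⟨_, hφM g⟩)
    simp only [Submodule.coe_sum, Submodule.coe_smul, Finset.sum_apply, Pi.smul_apply, smul_eq_mul] at h
    refine Eq.trans ?_ (h.symm.trans (Finset.sum_congr rfl fun j _ => mul_comm _ _))
    rfl
  have hle : kTranslateSpan (AutomorphyDatum.gl n K hcpt).ofArch φ ≤ Submodule.span ℂ (Set.range a) := by
    refine Submodule.span_le.2 ?_
    rintro _ ⟨c, rfl⟩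
    dsimp only
    rw [SetLike.mem_coe]
    refine (congrArg (· ∈ Submodule.span ℂ (Set.range a)) (key c)).mpr ?_
    exact Submodule.sum_mem _ fun j _ => Submodule.smul_mem _ _ (Submodule.subset_span ⟨j, rfl⟩)
  haveI : FiniteDimensional ℂ (Submodule.span ℂ (Set.range a)) :=
    FiniteDimensional.span_of_finite ℂ (Set.finite_range a)
  exact Submodule.finiteDimensional_of_le hle

end Slices

/-! ### 5. Moderate growth -/

section Growth

/-- **The first Levi function keeps the exponent of growth**: `‖ψ (x)‖ ≤ C (1 ⊔ ‖x‖)^r` on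
`GL_{k+l}(𝔸_K)` gives `‖(leviFunLeft ψ m₂)(m₁)‖ ≤ C' (1 ⊔ ‖m₁‖)^r` on `GL_k(𝔸_K)` (`k, l ≥ 1`;
`one_sup_adelicHeightGL_leviGL_le`). Moeglin–Waldspurger 1995, I.2.2, I.2.17.
[cite: MoeglinWaldspurger1995, I.2.17] -/
theorem exists_norm_leviFunLeft_le [NeZero k] [NeZero l] {ψ : GL (Fin (k + l)) (AdeleRing (𝓞 K) K) → ℂ}
    {C : ℝ} {r : ℕ} (hC : 0 ≤ C)
    (hgrowth : ∀ x, ‖ψ x‖ ≤ C * (1 ⊔ adelicHeightGL (k + l) K x) ^ r) (m₂ : GL (Fin l) (AdeleRing (𝓞 K) K)) :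
    ∃ C' : ℝ, ∀ m₁, ‖leviFunLeft ψ m₂ m₁‖ ≤ C' * (1 ⊔ adelicHeightGL k K m₁) ^ r := by
  set A : ℝ := ((k + l : ℕ) * k * l : ℝ) * (1 ⊔ adelicHeightGL l K m₂) with hA
  refine ⟨C * A ^ r, fun m₁ => (hgrowth _).trans ?_⟩
  have h := one_sup_adelicHeightGL_leviGL_le (K := K) m₁ m₂
  have h' : 1 ⊔ adelicHeightGL (k + l) K (leviGL (AdeleRing (𝓞 K) K) k l (m₁, m₂)) ≤
      A * (1 ⊔ adelicHeightGL k K m₁) := by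
    refine h.trans (le_of_eq ?_)
    simp only [hA]; ring
  have h0 : (0 : ℝ) ≤ 1 ⊔ adelicHeightGL (k + l) K (leviGL (AdeleRing (𝓞 K) K) k l (m₁, m₂)) :=
    zero_le_one.trans le_sup_left
  calc C * (1 ⊔ adelicHeightGL (k + l) K (leviGL (AdeleRing (𝓞 K) K) k l (m₁, m₂))) ^ r
      ≤ C * (A * (1 ⊔ adelicHeightGL k K m₁)) ^ r := by gcongr
    _ = C * A ^ r * (1 ⊔ adelicHeightGL k K m₁) ^ r := by rw [mul_pow]; ring

/-- **The second Levi function keeps the exponent of growth.** [cite: MoeglinWaldspurger1995, I.2.17] -/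
theorem exists_norm_leviFunRight_le [NeZero k] [NeZero l] {ψ : GL (Fin (k + l)) (AdeleRing (𝓞 K) K) → ℂ}
    {C : ℝ} {r : ℕ} (hC : 0 ≤ C)
    (hgrowth : ∀ x, ‖ψ x‖ ≤ C * (1 ⊔ adelicHeightGL (k + l) K x) ^ r) (m₁ : GL (Fin k) (AdeleRing (𝓞 K) K)) :
    ∃ C' : ℝ, ∀ m₂, ‖leviFunRight ψ m₁ m₂‖ ≤ C' * (1 ⊔ adelicHeightGL l K m₂) ^ r := by
  set A : ℝ := ((k + l : ℕ) * k * l : ℝ) * (1 ⊔ adelicHeightGL k K m₁) with hA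
  refine ⟨C * A ^ r, fun m₂ => (hgrowth _).trans ?_⟩
  have h := one_sup_adelicHeightGL_leviGL_le (K := K) m₁ m₂
  have h' : 1 ⊔ adelicHeightGL (k + l) K (leviGL (AdeleRing (𝓞 K) K) k l (m₁, m₂)) ≤
      A * (1 ⊔ adelicHeightGL l K m₂) := by
    refine h.trans (le_of_eq ?_)
    simp only [hA, mul_assoc]
  have h0 : (0 : ℝ) ≤ 1 ⊔ adelicHeightGL (k + l) K (leviGL (AdeleRing (𝓞 K) K) k l (m₁, m₂)) :=
    zero_le_one.trans le_sup_left
  calc C * (1 ⊔ adelicHeightGL (k + l) K (leviGL (AdeleRing (𝓞 K) K) k l (m₁, m₂))) ^ r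
      ≤ C * (A * (1 ⊔ adelicHeightGL l K m₂)) ^ r := by gcongr
    _ = C * A ^ r * (1 ⊔ adelicHeightGL l K m₂) ^ r := by rw [mul_pow]; ring

end Growth

/-! ### 6. Left invariance of the Levi functions of a constant term -/

section LeftInvariance

variable [MeasurableSpace (AdeleRing (𝓞 K) K)] [BorelSpace (AdeleRing (𝓞 K) K)]

/-- **The first Levi function of a constant term is left `GL_k(K)`-invariant**: for `φ` continuous and
left `GL_{k+l}(K)`-invariant, an additive Haar measure `ν` on the box and `γ ∈ GL_k(K)`,
`φ_P (diag(γ m₁, m₂)) = φ_P (diag(m₁, m₂))` (`diag(γ, 1) ∈ P_k(K)` and `φ_P` is left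
`P_k(K)`-invariant, `IsLeftInvariant.blockCT_parabolic_rational_mul`). Moeglin–Waldspurger 1995, I.2.6.
[cite: MoeglinWaldspurger1995, I.2.6] -/
theorem IsLeftInvariant.leviFunLeft_blockCT_rational_mul {φ : GL (Fin (k + l)) (AdeleRing (𝓞 K) K) → ℂ}
    (hφc : Continuous φ) (hφ : IsLeftInvariant (AdelicGroupData.gl (k + l) K) φ)
    (ν : MeasureTheory.Measure (BlockIdx (k + l) k → AdeleRing (𝓞 K) K)) [ν.IsAddHaarMeasure]
    (m₂ : GL (Fin l) (AdeleRing (𝓞 K) K)) (γ : GL (Fin k) K) (m₁ : GL (Fin k) (AdeleRing (𝓞 K) K)) :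
    leviFunLeft (blockCT (le_refl (k + l)) k ν φ) m₂
        (Matrix.GeneralLinearGroup.map (algebraMap K (AdeleRing (𝓞 K) K)) γ * m₁) =
      leviFunLeft (blockCT (le_refl (k + l)) k ν φ) m₂ m₁ := by
  rw [leviFunLeft_apply, leviFunLeft_apply]
  have e : leviGL (AdeleRing (𝓞 K) K) k l (Matrix.GeneralLinearGroup.map (algebraMap K (AdeleRing (𝓞 K) K)) γ * m₁, m₂) =
      Matrix.GeneralLinearGroup.map (algebraMap K (AdeleRing (𝓞 K) K)) (leviGL K k l (γ, 1)) *
        leviGL (AdeleRing (𝓞 K) K) k l (m₁, m₂) := by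
    rw [← leviGL_toAdelic, map_one, ← map_mul, Prod.mk_mul_mk, one_mul]
  rw [e]
  exact hφ.blockCT_parabolic_rational_mul hφc ν (leviGL_mem_standardParabolicGL (γ, 1)) _

/-- Hence the first Levi function of a constant term is left invariant under the arithmetic
subgroup of the `GL_k` datum. [cite: MoeglinWaldspurger1995, I.2.6] -/
theorem IsLeftInvariant.leviFunLeft_blockCT {φ : GL (Fin (k + l)) (AdeleRing (𝓞 K) K) → ℂ}
    (hφc : Continuous φ) (hφ : IsLeftInvariant (AdelicGroupData.gl (k + l) K) φ)
    (ν : MeasureTheory.Measure (BlockIdx (k + l) k → AdeleRing (𝓞 K) K)) [ν.IsAddHaarMeasure]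
    (m₂ : GL (Fin l) (AdeleRing (𝓞 K) K)) :
    IsLeftInvariant (AdelicGroupData.gl k K) (leviFunLeft (blockCT (le_refl (k + l)) k ν φ) m₂) := by
  rintro _ ⟨γ, rfl⟩ m₁
  exact hφ.leviFunLeft_blockCT_rational_mul hφc ν m₂ γ m₁

/-- **The second Levi function of a constant term is left `GL_l(K)`-invariant** (`diag(1, γ) ∈ P_k(K)`).
[cite: MoeglinWaldspurger1995, I.2.6] -/
theorem IsLeftInvariant.leviFunRight_blockCT_rational_mul {φ : GL (Fin (k + l)) (AdeleRing (𝓞 K) K) → ℂ}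
    (hφc : Continuous φ) (hφ : IsLeftInvariant (AdelicGroupData.gl (k + l) K) φ)
    (ν : MeasureTheory.Measure (BlockIdx (k + l) k → AdeleRing (𝓞 K) K)) [ν.IsAddHaarMeasure]
    (m₁ : GL (Fin k) (AdeleRing (𝓞 K) K)) (γ : GL (Fin l) K) (m₂ : GL (Fin l) (AdeleRing (𝓞 K) K)) :
    leviFunRight (blockCT (le_refl (k + l)) k ν φ) m₁
        (Matrix.GeneralLinearGroup.map (algebraMap K (AdeleRing (𝓞 K) K)) γ * m₂) =
      leviFunRight (blockCT (le_refl (k + l)) k ν φ) m₁ m₂ := by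
  rw [leviFunRight_apply, leviFunRight_apply]
  have e : leviGL (AdeleRing (𝓞 K) K) k l (m₁, Matrix.GeneralLinearGroup.map (algebraMap K (AdeleRing (𝓞 K) K)) γ * m₂) =
      Matrix.GeneralLinearGroup.map (algebraMap K (AdeleRing (𝓞 K) K)) (leviGL K k l (1, γ)) *
        leviGL (AdeleRing (𝓞 K) K) k l (m₁, m₂) := by
    rw [← leviGL_toAdelic, map_one, ← map_mul, Prod.mk_mul_mk, one_mul]
  rw [e]
  exact hφ.blockCT_parabolic_rational_mul hφc ν (leviGL_mem_standardParabolicGL (1, γ)) _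

/-- Hence the second Levi function of a constant term is left invariant under the arithmetic
subgroup of the `GL_l` datum. [cite: MoeglinWaldspurger1995, I.2.6] -/
theorem IsLeftInvariant.leviFunRight_blockCT {φ : GL (Fin (k + l)) (AdeleRing (𝓞 K) K) → ℂ}
    (hφc : Continuous φ) (hφ : IsLeftInvariant (AdelicGroupData.gl (k + l) K) φ)
    (ν : MeasureTheory.Measure (BlockIdx (k + l) k → AdeleRing (𝓞 K) K)) [ν.IsAddHaarMeasure]
    (m₁ : GL (Fin k) (AdeleRing (𝓞 K) K)) :
    IsLeftInvariant (AdelicGroupData.gl l K) (leviFunRight (blockCT (le_refl (k + l)) k ν φ) m₁) := by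
  rintro _ ⟨γ, rfl⟩ m₂
  exact hφ.leviFunRight_blockCT_rational_mul hφc ν m₁ γ m₂

end LeftInvariance

end Literature.NumberTheory.Automorphic
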